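import Mathlib.Algebra.GroupWithZero.NonZeroDivisors
import Mathlib.Data.ZMod.Basic
import Mathlib.Tactic.Ring
import Mathlib.Tactic.LinearCombination
import Literature.Algebra.EuclideanDomain.MotzkinConstruction
import HarnessLib

/-!
# Superadditivity of the smallest algorithm beyond domains (Samuel 1971, Proposition 12 — corrected) and
# its failure for zero-divisors

Topic `Literature/Algebra/EuclideanDomain`, namespace `Literature.Algebra.EuclideanDomain`.  THEOREMS ONLY (no
`def`, no instance, no named fact), all proved, in the vocabulary of `MotzkinConstruction.lean`: `motzkinSet k =
P₀^{(k)}` (so that Samuel's finite stages are `A_k = (P₀^{(k)})ᶜ`, cf. `IntProdIntTransfiniteEuclidean.lean`),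
`motzkinRank`, `motzkinNorm` (Samuel's integer-valued `θ` of Prop. 12 on non-zero elements).

## Source (read at the page), and what is wrong with it

P. Samuel, *About Euclidean rings*, J. Algebra **19** (1971) 282–301 [Samuel1971] (materialised
`paper:doi-10-1016-0021-8693-71-90110-4`, p. 291), VERBATIM: **Proposition 12.** «Let `A` be a ring, `(A_n)_{n∈ℕ}` the
beginning of its transfinite construction, and `A′ = ⋃_{n≥0} A_n`.  We set `θ(x) = n` for `x ∈ A_{n+1} − A_n` (thus
`θ(unit) = 0`, `θ(0) = −1`).  If `a, b` are nonzero elements of `A` such that `ab ∈ A′`, then `a, b ∈ A′` and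
`θ(ab) ≥ θ(a) + θ(b)`.»  Proof (p. 291): «For some `n`, `A_n → A/Aab` is surjective, thus `A_n → A/Aa` is also
surjective.  This proves that `a ∈ A′` … we fix `b`, and suppose that there exist nonzero elements `a` of `A` such that
`θ(ab) < θ(a) + θ(b)`.  Among these elements we choose an `a` such that (1) the difference `θ(ab) − θ(a)` takes its
minimum value, say `h`; (2) among the elements `a′` such that `θ(a′b) − θ(a′) = h`, `a` has the smallest value for
`θ` … there exists a coset `c + Aa` containing an element `x₀ ∈ A′` such that `θ(x₀) = θ(a) − 1` and that
`θ(x) ≥ θ(a) − 1` for every `x ∈ A′ ∩ (c + Aa)`.  Consider the coset `cb + Aab`.  Since `ab ∈ A′`, this coset contains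
an element `y ∈ A′` such that `θ(y) ≤ θ(ab) − 1`.  We have `y = xb` with `x ∈ c + Aa`, whence `x ∈ A′` … If
`θ(x) = θ(a) − 1` … this contradicts (2) … Otherwise … in contradiction with (1).»

**The printed statement is false for rings with zero-divisors** (§4 below, kernel-checked): in `ℤ/6ℤ` the finite
construction is `A₀ = {0} ⊂ A₁ = {0, ±1} ⊂ A₂ = ℤ/6ℤ` (every non-zero non-unit `2, 3, 4` is a universal side divisor),
so `θ(2) = θ(4) = 1` although `2 · 2 = 4 ≠ 0`: `θ(ab) = 1 < 2 = θ(a) + θ(b)` (`ZMod6.motzkinNorm_two_mul_two_lt`,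
`ZMod6.not_superadditive`); likewise `3 · 3 = 3`.  More generally a non-zero non-unit IDEMPOTENT `e ∈ A′` always violates
it (`exists_not_mul_self_mem_motzkinSet_of_idempotent`).  The gap in the proof is the sentence «this coset contains an
element `y ∈ A′` such that `θ(y) ≤ θ(ab) − 1`.  We have `y = xb`»: the element `y = xb` may be `0` (`θ(0) = −1`), and
then nothing forces `x` to be a violator with smaller invariants; this cannot happen when `b` is not a zero-divisor
(`x ≠ 0` because `0 ∈ A_{θ(a)−1}` does not lie in the coset `c + Aa`).  **Corrected statement, proved here by Samuel's
own double minimisation** (organised as a lexicographic induction on `(θ(ab) − θ(a), θ(a))`): the conclusion holds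
when `b` (or, symmetrically, `a`) is a NON-ZERO-DIVISOR.  For an integral domain this is Lenstra's / Conidis–Nielsen–
Tombs' Lemma 5, already in the tree (`MinimalEuclideanFunctionSuperadditive.lean`: `mul_mem_motzkinSet_add`,
`motzkinNorm_add_le_motzkinNorm_mul`, hypotheses `[IsDomain R]`, `y ≠ 0`); the present file removes `IsDomain`.

## What is formalised

* §1 «`A_n → A/Aab` surjective, thus `A_n → A/Aa` also»: `mul_mem_motzkinSet_of_mul_ne_zero` (`P₀^{(k)}·c ⊆ P₀^{(k)}`
  for products `bc ≠ 0`, in ANY commutative ring — Motzkin's «product ideal» property without `IsDomain`) and the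
  first claim of Prop. 12, `exists_not_mem_motzkinSet_of_mul`.
* §2 THE SET FORM (the heart): `mul_mem_motzkinSet_add_of_mem_nonZeroDivisors` — `x ∈ P₀^{(i)}`, `y ∈ P₀^{(j)} ∩ R⁰`
  ⟹ `xy ∈ P₀^{(i+j)}` — and its mirror image; the inductive kernel `not_mem_motzkinSet_le_add_aux` is Samuel's
  minimal-counterexample argument with `h = f − i` and `θ(a) ↔ i`.
* §3 Prop. 12 in Samuel's `θ`-form under Motzkin's criterion (`θ = motzkinNorm`):
  `motzkinNorm_add_le_motzkinNorm_mul_of_mem_nonZeroDivisors` («`θ(ab) ≥ θ(a) + θ(b)`» for `a ≠ 0`, `b ∈ R⁰`), the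
  rank form, and powers of a non-zero-divisor.
* §4 The counterexample `ℤ/6ℤ` and the idempotent obstruction.

## Mathlib / tree search

Tree: `MotzkinConstruction.lean` (`motzkinSet_succ`, `mem_motzkinDerived`, `motzkinSet_one`, `motzkinSet_two`,
`motzkinSet_subset_of_le`, `ne_zero_of_mem_motzkinSet`, `motzkinRank_le_iff`, `motzkinRank_eq_zero_iff`,
`mem_motzkinSet_of_lt_motzkinRank`, `mem_motzkinSet_motzkinNorm`; the domain-only `mul_mem_motzkinSet`),
`MinimalEuclideanFunctionSuperadditive.lean` (domain case; not imported — nothing of it is reused),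
`IsUniversalSideDivisor` (`UniversalSideDivisors.lean`).  Mathlib: `nonZeroDivisors`,
`mul_right_mem_nonZeroDivisors_eq_zero_iff`, `ZMod`; `rg nonZeroDivisors Literature/Algebra/EuclideanDomain` → none.
-/

namespace Literature.Algebra.EuclideanDomain

universe u

variable {R : Type u} [CommRing R]

open scoped nonZeroDivisors

/-! ## §1 `A_n → A/Aab` surjective ⟹ `A_n → A/Aa` surjective -/

/-- Motzkin's «product ideal» property in any commutative ring: if `b ∈ P₀^{(k)}` and `bc ≠ 0` then `bc ∈ P₀^{(k)}`
(the witness `a` of `b ∈ (P₀^{(k-1)})′`, `a + bR ⊆ P₀^{(k-1)}`, serves `bc` since `a + bcR ⊆ a + bR`).  In Samuel's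
words: the classes mod `Ab` are unions of classes mod `Abc`, so «`A_n → A/Aab` is surjective, thus `A_n → A/Aa` is
also surjective». [cite: Samuel1971, Prop. 12 (p. 291)] -/
theorem mul_mem_motzkinSet_of_mul_ne_zero {k : ℕ} {b c : R} (hb : b ∈ (motzkinSet k : Set R))
    (h0 : b * c ≠ 0) : b * c ∈ (motzkinSet k : Set R) := by
  induction k with
  | zero => rwa [motzkinSet_zero, Set.mem_setOf_eq]
  | succ k ih =>
    rw [motzkinSet_succ, mem_motzkinDerived] at hb ⊢
    obtain ⟨hbk, a, ha⟩ := hb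
    exact ⟨ih hbk, a, fun q ↦ by rw [mul_assoc]; exact ha (c * q)⟩

/-- The same on the left: `c ∈ P₀^{(k)}`, `bc ≠ 0` ⟹ `bc ∈ P₀^{(k)}`. [cite: Samuel1971, Prop. 12 (p. 291)] -/
theorem mul_mem_motzkinSet_of_mul_ne_zero' {k : ℕ} {b c : R} (hc : c ∈ (motzkinSet k : Set R))
    (h0 : b * c ≠ 0) : b * c ∈ (motzkinSet k : Set R) := by
  rw [mul_comm] at h0 ⊢
  exact mul_mem_motzkinSet_of_mul_ne_zero hc h0

/-- First claim of Prop. 12: «If `a, b` are nonzero elements of `A` such that `ab ∈ A′`, then `a, b ∈ A′`» — for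
`ab ≠ 0` (which the printed «nonzero» must mean: with `ab = 0 ∈ A₀` the claim fails, e.g. `a = (1,0)`, `b = (0,1)`
in `ℤ × ℤ`): if `ab ∉ P₀^{(n)}` then `a ∉ P₀^{(n)}`. [cite: Samuel1971, Prop. 12 (p. 291)] -/
theorem exists_not_mem_motzkinSet_of_mul {a b : R} (h : ∃ n : ℕ, a * b ∉ (motzkinSet n : Set R))
    (h0 : a * b ≠ 0) :
    (∃ n : ℕ, a ∉ (motzkinSet n : Set R)) ∧ ∃ n : ℕ, b ∉ (motzkinSet n : Set R) := by
  obtain ⟨n, hn⟩ := h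
  exact ⟨⟨n, fun ha ↦ hn (mul_mem_motzkinSet_of_mul_ne_zero ha h0)⟩,
    ⟨n, fun hb ↦ hn (mul_mem_motzkinSet_of_mul_ne_zero' hb h0)⟩⟩

/-! ## §2 The corrected Proposition 12, set form -/

/-- **Samuel's double minimisation**, as an induction.  Fix `y ∈ P₀^{(j)}` that is not a zero-divisor.  There is no
`x` with `x ∈ P₀^{(i)}`, `xy ∉ P₀^{(f)}` and `f ≤ i + j` (a «violator»; `n = f − i` is Samuel's `h = θ(ab) − θ(a)` up
to the shift, `i` plays `θ(a)`): by strong induction on `n`, then on `i`.  Given a violator, `xy ∈ P₀^{(i)} ∩ P₀^{(j)}`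
(§1, `xy ≠ 0` as `y ∈ R⁰`), so `f > i`, `f > j`, `i ≥ 1`; if already `xy ∉ P₀^{(f-1)}`, recurse with smaller `n`;
otherwise every class mod `xy` meets `(P₀^{(f-1)})ᶜ` while some class `c₀ + xR` lies in `P₀^{(i-1)}` (as
`x ∈ (P₀^{(i-1)})′`): the class of `c₀y` mod `xy` yields `t` with `zy = c₀y + xyt ∉ P₀^{(f-1)}`, `z = c₀ + xt ∈
P₀^{(i-1)}` — a violator with the same `n` and smaller `i` («If `θ(x) = θ(a) − 1` … contradicts (2).  Otherwise …
contradiction with (1)»). [cite: Samuel1971, Prop. 12 (p. 291), proof] -/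
theorem not_mem_motzkinSet_le_add_aux {j : ℕ} {y : R} (hy : y ∈ (motzkinSet j : Set R)) (hy0 : y ∈ R⁰) :
    ∀ n i : ℕ, ∀ x : R, ∀ f : ℕ, x ∈ (motzkinSet i : Set R) → x * y ∉ (motzkinSet f : Set R) →
      f ≤ i + j → f - i = n → False := by
  intro n
  refine Nat.strong_induction_on n ?_
  intro n ihn i
  refine Nat.strong_induction_on i ?_
  intro i ihi x f hx hxy hf hn
  have hx0 : x ≠ 0 := ne_zero_of_mem_motzkinSet hx
  have hxy0 : x * y ≠ 0 := fun h ↦ hx0 ((mul_right_mem_nonZeroDivisors_eq_zero_iff hy0).1 h)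
  -- `xy ∈ P₀^{(i)}` and `xy ∈ P₀^{(j)}`, hence `i < f`, `j < f`, `1 ≤ i`
  have hxyi : x * y ∈ (motzkinSet i : Set R) := mul_mem_motzkinSet_of_mul_ne_zero hx hxy0
  have hxyj : x * y ∈ (motzkinSet j : Set R) := mul_mem_motzkinSet_of_mul_ne_zero' hy hxy0
  have hfi : i < f := lt_of_not_ge fun hfi ↦ hxy (motzkinSet_subset_of_le hfi hxyi)
  have hfj : j < f := lt_of_not_ge fun hfj ↦ hxy (motzkinSet_subset_of_le hfj hxyj)
  obtain ⟨f', rfl⟩ : ∃ f', f = f' + 1 := ⟨f - 1, by omega⟩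
  rw [motzkinSet_succ, mem_motzkinDerived, not_and_or] at hxy
  rcases hxy with hxy' | hxy'
  · -- `xy ∉ P₀^{(f')}` already: smaller `n`
    exact ihn (f' - i) (by omega) i x f' hx hxy' (by omega) rfl
  · -- every class mod `xy` meets the complement of `P₀^{(f')}`
    push Not at hxy'
    obtain ⟨i', rfl⟩ : ∃ i', i = i' + 1 := ⟨i - 1, by omega⟩
    rw [motzkinSet_succ, mem_motzkinDerived] at hx
    obtain ⟨-, c₀, hc₀⟩ := hx
    obtain ⟨t, ht⟩ := hxy' (c₀ * y)
    have hz : c₀ + x * t ∈ (motzkinSet i' : Set R) := hc₀ t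
    have hzy : (c₀ + x * t) * y ∉ (motzkinSet f' : Set R) := by
      rwa [show (c₀ + x * t) * y = c₀ * y + x * y * t by ring]
    exact ihi i' (by omega) (c₀ + x * t) f' hz hzy (by omega) (by omega)

/-- **Proposition 12, corrected — set form.**  In any commutative ring: if `x ∈ P₀^{(i)}` and `y ∈ P₀^{(j)}` is NOT
a zero-divisor, then `xy ∈ P₀^{(i+j)}` (`P₀^{(i)} · (P₀^{(j)} ∩ R⁰) ⊆ P₀^{(i+j)}`).  For an integral domain this is
`mul_mem_motzkinSet_add` of `MinimalEuclideanFunctionSuperadditive.lean`; without the non-zero-divisor hypothesis it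
fails (§4). [cite: Samuel1971, Prop. 12 (p. 291)] -/
theorem mul_mem_motzkinSet_add_of_mem_nonZeroDivisors {i j : ℕ} {x y : R} (hx : x ∈ (motzkinSet i : Set R))
    (hy : y ∈ (motzkinSet j : Set R)) (hy0 : y ∈ R⁰) : x * y ∈ (motzkinSet (i + j) : Set R) := by
  by_contra hxy
  exact not_mem_motzkinSet_le_add_aux hy hy0 _ i x (i + j) hx hxy le_rfl rfl

/-- The mirror image: `x ∈ P₀^{(i)} ∩ R⁰`, `y ∈ P₀^{(j)}` ⟹ `xy ∈ P₀^{(i+j)}`. [cite: Samuel1971, Prop. 12 (p. 291)] -/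
theorem mul_mem_motzkinSet_add_of_mem_nonZeroDivisors' {i j : ℕ} {x y : R} (hx : x ∈ (motzkinSet i : Set R))
    (hx0 : x ∈ R⁰) (hy : y ∈ (motzkinSet j : Set R)) : x * y ∈ (motzkinSet (i + j) : Set R) := by
  rw [mul_comm, add_comm]
  exact mul_mem_motzkinSet_add_of_mem_nonZeroDivisors hy hx hx0

/-- Powers of a non-zero-divisor: `y ∈ P₀^{(j)} ∩ R⁰` ⟹ `yⁿ ∈ P₀^{(n·j)}`. [cite: Samuel1971, Prop. 12 (p. 291)] -/
theorem pow_mem_motzkinSet_mul_of_mem_nonZeroDivisors {j : ℕ} {y : R} (hy : y ∈ (motzkinSet j : Set R))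
    (hy0 : y ∈ R⁰) (n : ℕ) : y ^ n ∈ (motzkinSet (n * j) : Set R) := by
  induction n with
  | zero =>
    rw [Nat.zero_mul, pow_zero, motzkinSet_zero, Set.mem_setOf_eq]
    -- `1 ≠ 0`: the ring is non-trivial since `y ≠ 0`
    intro h10
    exact ne_zero_of_mem_motzkinSet hy (by rw [← one_mul y, h10, zero_mul])
  | succ n ih =>
    rw [pow_succ, Nat.succ_mul]
    exact mul_mem_motzkinSet_add_of_mem_nonZeroDivisors ih hy hy0

/-! ## §3 Proposition 12 in `θ`-form (under Motzkin's criterion, `θ = motzkinNorm`) -/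

section Norm

variable (h : ∀ b : R, ∃ k : ℕ, b ∉ (motzkinSet k : Set R))

/-- Rank form: `rank x + rank y ≤ rank (xy) + 1` for `x ≠ 0` and `y` a non-zero-divisor (`rank = θ + 1` off `0`).
[cite: Samuel1971, Prop. 12 (p. 291)] -/
theorem motzkinRank_add_le_motzkinRank_mul_add_one_of_mem_nonZeroDivisors {x y : R} (hx : x ≠ 0)
    (hy : y ∈ R⁰) : motzkinRank h x + motzkinRank h y ≤ motzkinRank h (x * y) + 1 := by
  have hy' : y ≠ 0 := fun hy0 ↦ hx ((mul_right_mem_nonZeroDivisors_eq_zero_iff hy).1 (by rw [hy0, mul_zero]))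
  have hx1 : motzkinRank h x ≠ 0 := fun e ↦ hx ((motzkinRank_eq_zero_iff h).mp e)
  have hy1 : motzkinRank h y ≠ 0 := fun e ↦ hy' ((motzkinRank_eq_zero_iff h).mp e)
  have hxm : x ∈ (motzkinSet (motzkinRank h x - 1) : Set R) :=
    mem_motzkinSet_of_lt_motzkinRank h (by omega)
  have hym : y ∈ (motzkinSet (motzkinRank h y - 1) : Set R) :=
    mem_motzkinSet_of_lt_motzkinRank h (by omega)
  have hxy := mul_mem_motzkinSet_add_of_mem_nonZeroDivisors hxm hym hy
  by_contra hlt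
  have hle : motzkinRank h (x * y) ≤ motzkinRank h x - 1 + (motzkinRank h y - 1) := by omega
  exact (motzkinRank_le_iff h).mp hle hxy

/-- **Proposition 12 (corrected): «`θ(ab) ≥ θ(a) + θ(b)`»** for `a ≠ 0` and `b` NOT A ZERO-DIVISOR, `θ` = the smallest
(integer-valued) algorithm = `motzkinNorm` on non-zero elements («`θ(unit) = 0`»), in a ring exhausted by the finite
construction. [cite: Samuel1971, Prop. 12 (p. 291)] -/
theorem motzkinNorm_add_le_motzkinNorm_mul_of_mem_nonZeroDivisors {x y : R} (hx : x ≠ 0) (hy : y ∈ R⁰) :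
    motzkinNorm h x + motzkinNorm h y ≤ motzkinNorm h (x * y) := by
  have := motzkinRank_add_le_motzkinRank_mul_add_one_of_mem_nonZeroDivisors h hx hy
  have hy' : y ≠ 0 := fun hy0 ↦ hx ((mul_right_mem_nonZeroDivisors_eq_zero_iff hy).1 (by rw [hy0, mul_zero]))
  have hx1 : motzkinRank h x ≠ 0 := fun e ↦ hx ((motzkinRank_eq_zero_iff h).mp e)
  have hy1 : motzkinRank h y ≠ 0 := fun e ↦ hy' ((motzkinRank_eq_zero_iff h).mp e)
  unfold motzkinNorm
  omega

/-- The symmetric form: `a` not a zero-divisor, `b ≠ 0`. [cite: Samuel1971, Prop. 12 (p. 291)] -/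
theorem motzkinNorm_add_le_motzkinNorm_mul_of_mem_nonZeroDivisors' {x y : R} (hx : x ∈ R⁰) (hy : y ≠ 0) :
    motzkinNorm h x + motzkinNorm h y ≤ motzkinNorm h (x * y) := by
  rw [add_comm, mul_comm]
  exact motzkinNorm_add_le_motzkinNorm_mul_of_mem_nonZeroDivisors h hy hx

/-- Powers: `n · θ(y) ≤ θ(yⁿ)` for a non-zero-divisor `y`. [cite: Samuel1971, Prop. 12 (p. 291)] -/
theorem mul_motzkinNorm_le_motzkinNorm_pow_of_mem_nonZeroDivisors {y : R} (hy : y ∈ R⁰) (hy' : y ≠ 0) (n : ℕ) :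
    n * motzkinNorm h y ≤ motzkinNorm h (y ^ n) := by
  induction n with
  | zero => simp
  | succ n ih =>
    have hyn : y ^ n ≠ 0 := by
      -- `yⁿ` is again a non-zero-divisor, in particular non-zero (the ring is non-trivial as `y ≠ 0`)
      intro h0
      have : (1 : R) = 0 := (mul_right_mem_nonZeroDivisors_eq_zero_iff (pow_mem hy n)).1 (by rw [h0, mul_zero])
      exact hy' (by rw [← one_mul y, this, zero_mul])
    have := motzkinNorm_add_le_motzkinNorm_mul_of_mem_nonZeroDivisors h hyn hy
    rw [← pow_succ] at this
    rw [Nat.succ_mul]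
    omega

end Norm

/-! ## §4 The printed Proposition 12 fails for zero-divisors: idempotents, and `ℤ/6ℤ` -/

/-- Between a stage containing `e` and a stage not containing it there is a last stage containing `e`.
[cite: Motzkin1949, §1 (p. 1143)] -/
theorem exists_mem_motzkinSet_and_not_mem_succ {e : R} {i₀ k : ℕ} (h0 : e ∈ (motzkinSet i₀ : Set R))
    (hk : e ∉ (motzkinSet k : Set R)) :
    ∃ i : ℕ, i₀ ≤ i ∧ e ∈ (motzkinSet i : Set R) ∧ e ∉ (motzkinSet (i + 1) : Set R) := by
  induction k with
  | zero => exact absurd (motzkinSet_subset_of_le (Nat.zero_le i₀) h0) hk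
  | succ k ih =>
    by_cases hk' : e ∈ (motzkinSet k : Set R)
    · refine ⟨k, ?_, hk', hk⟩
      by_contra hlt
      exact hk (motzkinSet_subset_of_le (by omega) h0)
    · exact ih hk'

/-- **The idempotent obstruction.**  A non-zero non-unit idempotent `e` (`e ∈ P₀′`) lying in `A′` (`e ∉ P₀^{(k)}` for
some `k`) violates the printed Proposition 12: `e ∈ P₀^{(i)}` for some `i ≥ 1` while `e · e = e ∉ P₀^{(i+i)}`, although
`e · e ≠ 0` — i.e. `θ(e·e) = θ(e) < 2θ(e)`.  (Idempotents `≠ 0, 1` are zero-divisors.) [cite: Samuel1971, Prop. 12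
(p. 291) — counterexample to the statement as printed] -/
theorem exists_not_mul_self_mem_motzkinSet_of_idempotent {e : R} (he : e * e = e)
    (h1 : e ∈ (motzkinSet 1 : Set R)) {k : ℕ} (hk : e ∉ (motzkinSet k : Set R)) :
    e * e ≠ 0 ∧ ∃ i : ℕ, 1 ≤ i ∧ e ∈ (motzkinSet i : Set R) ∧ e * e ∉ (motzkinSet (i + i) : Set R) := by
  obtain ⟨i, hi, hei, hei'⟩ := exists_mem_motzkinSet_and_not_mem_succ h1 hk
  refine ⟨by rw [he]; exact ne_zero_of_mem_motzkinSet h1, i, hi, hei, fun h ↦ hei' ?_⟩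
  rw [he] at h
  exact motzkinSet_subset_of_le (by omega) h

/-- In `ℤ/6ℤ`: `2v ≠ 1`, `3v ≠ 1`, `4v ≠ 1` for all `v`. [cite: Samuel1971, Prop. 12 (p. 291) — counterexample] -/
theorem ZMod6.mul_ne_one : ∀ v : ZMod 6, 2 * v ≠ 1 ∧ 3 * v ≠ 1 ∧ 4 * v ≠ 1 := by decide

/-- The non-units `2, 3, 4` of `ℤ/6ℤ`. [cite: Samuel1971, Prop. 12 (p. 291) — counterexample] -/
theorem ZMod6.not_isUnit :
    ¬IsUnit (2 : ZMod 6) ∧ ¬IsUnit (3 : ZMod 6) ∧ ¬IsUnit (4 : ZMod 6) := by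
  refine ⟨fun h ↦ ?_, fun h ↦ ?_, fun h ↦ ?_⟩
  · obtain ⟨v, hv⟩ := h.exists_right_inv
    exact (ZMod6.mul_ne_one v).1 hv
  · obtain ⟨v, hv⟩ := h.exists_right_inv
    exact (ZMod6.mul_ne_one v).2.1 hv
  · obtain ⟨v, hv⟩ := h.exists_right_inv
    exact (ZMod6.mul_ne_one v).2.2 hv

/-- `5` is a unit of `ℤ/6ℤ` (`5 · 5 = 1`). [cite: Samuel1971, Prop. 12 (p. 291) — counterexample] -/
theorem ZMod6.isUnit_five : IsUnit (5 : ZMod 6) :=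
  IsUnit.of_mul_eq_one (5 : ZMod 6) (by decide)

/-- Representatives `0` or a unit of every class mod `2`, mod `3` and mod `4` in `ℤ/6ℤ` (pure arithmetic, by `decide`).
[cite: Samuel1971, Prop. 12 (p. 291) — counterexample] -/
theorem ZMod6.exists_rep : ∀ x : ZMod 6,
    (∃ z c : ZMod 6, (z = 0 ∨ z = 1) ∧ x - z = 2 * c) ∧ (∃ z c : ZMod 6, (z = 0 ∨ z = 1 ∨ z = 5) ∧ x - z = 3 * c) ∧
      ∃ z c : ZMod 6, (z = 0 ∨ z = 1) ∧ x - z = 4 * c := by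
  decide

/-- `2`, `3` and `4` are universal side divisors of `ℤ/6ℤ` — every class mod each of them contains `0` or a unit — so
that `A₂ = ℤ/6ℤ` (`P₀″ = ∅`). [cite: Samuel1971, Prop. 12 (p. 291) — counterexample; §4 (4.6) (p. 289)] -/
theorem ZMod6.isUniversalSideDivisor :
    IsUniversalSideDivisor (2 : ZMod 6) ∧ IsUniversalSideDivisor (3 : ZMod 6) ∧
      IsUniversalSideDivisor (4 : ZMod 6) := by
  obtain ⟨h2, h3, h4⟩ := ZMod6.not_isUnit
  refine ⟨⟨by decide, h2, fun x ↦ ?_⟩, ⟨by decide, h3, fun x ↦ ?_⟩, ⟨by decide, h4, fun x ↦ ?_⟩⟩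
  · obtain ⟨⟨z, c, hz, hc⟩, -, -⟩ := ZMod6.exists_rep x
    refine ⟨z, ?_, c, hc⟩
    rcases hz with rfl | rfl
    · exact Or.inl rfl
    · exact Or.inr isUnit_one
  · obtain ⟨-, ⟨z, c, hz, hc⟩, -⟩ := ZMod6.exists_rep x
    refine ⟨z, ?_, c, hc⟩
    rcases hz with rfl | rfl | rfl
    · exact Or.inl rfl
    · exact Or.inr isUnit_one
    · exact Or.inr ZMod6.isUnit_five
  · obtain ⟨-, -, ⟨z, c, hz, hc⟩⟩ := ZMod6.exists_rep x
    refine ⟨z, ?_, c, hc⟩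
    rcases hz with rfl | rfl
    · exact Or.inl rfl
    · exact Or.inr isUnit_one

/-- `2 ∈ P₀′` in `ℤ/6ℤ` (a non-zero non-unit): `θ(2) ≥ 1`. [cite: Samuel1971, Prop. 12 (p. 291) — counterexample] -/
theorem ZMod6.two_mem_motzkinSet_one : (2 : ZMod 6) ∈ (motzkinSet 1 : Set (ZMod 6)) := by
  rw [motzkinSet_one]
  exact ⟨by decide, ZMod6.not_isUnit.1⟩

/-- `P₀″ = ∅` in `ℤ/6ℤ`: the finite construction is `A₀ = {0} ⊂ A₁ = {0, 1, 5} ⊂ A₂ = ℤ/6ℤ`.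
[cite: Samuel1971, Prop. 12 (p. 291) — counterexample; §4 (4.6) (p. 289)] -/
theorem ZMod6.motzkinSet_two_eq_empty : (motzkinSet 2 : Set (ZMod 6)) = ∅ := by
  rw [motzkinSet_two]
  refine Set.eq_empty_of_forall_notMem fun b hb ↦ ?_
  obtain ⟨hb0, hbu, hbU⟩ := hb
  obtain ⟨U2, U3, U4⟩ := ZMod6.isUniversalSideDivisor
  have hcases : ∀ b : ZMod 6, b = 0 ∨ b = 1 ∨ b = 5 ∨ b = 2 ∨ b = 3 ∨ b = 4 := by decide
  rcases hcases b with rfl | rfl | rfl | rfl | rfl | rfl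
  · exact hb0 rfl
  · exact hbu isUnit_one
  · exact hbu ZMod6.isUnit_five
  · exact hbU U2
  · exact hbU U3
  · exact hbU U4

/-- Motzkin's criterion holds in `ℤ/6ℤ` (every element has left the sequence by stage `2`), so the smallest algorithm
`θ = motzkinNorm` is defined. [cite: Samuel1971, Prop. 12 (p. 291) — counterexample] -/
theorem ZMod6.forall_exists_not_mem_motzkinSet : ∀ b : ZMod 6, ∃ k : ℕ, b ∉ (motzkinSet k : Set (ZMod 6)) :=
  fun b ↦ ⟨2, by rw [ZMod6.motzkinSet_two_eq_empty]; exact fun h ↦ h⟩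

/-- **The printed Proposition 12 fails (set form)**: in `ℤ/6ℤ`, `x = y = 2 ∈ P₀′ = P₀^{(1)}`, `xy = 4 ≠ 0`, but
`xy ∉ P₀^{(1+1)} = ∅`. [cite: Samuel1971, Prop. 12 (p. 291) — counterexample to the statement as printed] -/
theorem ZMod6.two_mul_two_not_mem_motzkinSet_two :
    (2 : ZMod 6) ∈ (motzkinSet 1 : Set (ZMod 6)) ∧ (2 : ZMod 6) * 2 ≠ 0 ∧
      (2 : ZMod 6) * 2 ∉ (motzkinSet (1 + 1) : Set (ZMod 6)) :=
  ⟨ZMod6.two_mem_motzkinSet_one, by decide, by rw [ZMod6.motzkinSet_two_eq_empty]; exact fun h ↦ h⟩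

/-- Hence the hypothesis «`y` not a zero-divisor» of `mul_mem_motzkinSet_add_of_mem_nonZeroDivisors` cannot be weakened
to «`xy ≠ 0`». [cite: Samuel1971, Prop. 12 (p. 291) — counterexample to the statement as printed] -/
theorem ZMod6.not_forall_mul_mem_motzkinSet_add :
    ¬ ∀ (i j : ℕ) (x y : ZMod 6), x ∈ (motzkinSet i : Set (ZMod 6)) → y ∈ (motzkinSet j : Set (ZMod 6)) →
      x * y ≠ 0 → x * y ∈ (motzkinSet (i + j) : Set (ZMod 6)) := by
  intro H
  obtain ⟨h1, h0, h2⟩ := ZMod6.two_mul_two_not_mem_motzkinSet_two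
  exact h2 (H 1 1 2 2 h1 h1 h0)

/-- `θ(2) = 1` in `ℤ/6ℤ` (rank `2`: `2 ∈ P₀′`, `2 ∉ P₀″`). [cite: Samuel1971, Prop. 12 (p. 291) — counterexample] -/
theorem ZMod6.motzkinNorm_two : motzkinNorm ZMod6.forall_exists_not_mem_motzkinSet (2 : ZMod 6) = 1 := by
  have h2 : motzkinRank ZMod6.forall_exists_not_mem_motzkinSet (2 : ZMod 6) = 2 := by
    refine le_antisymm ((motzkinRank_le_iff _).2 ?_) ?_
    · rw [ZMod6.motzkinSet_two_eq_empty]; exact fun h ↦ h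
    · by_contra hlt
      exact (motzkinRank_le_iff _).1 (Nat.lt_succ_iff.1 (lt_of_not_ge hlt)) ZMod6.two_mem_motzkinSet_one
  unfold motzkinNorm
  rw [h2]

/-- `θ(2 · 2) = θ(4) = 1` in `ℤ/6ℤ`. [cite: Samuel1971, Prop. 12 (p. 291) — counterexample] -/
theorem ZMod6.motzkinNorm_two_mul_two :
    motzkinNorm ZMod6.forall_exists_not_mem_motzkinSet ((2 : ZMod 6) * 2) = 1 := by
  have h41 : (2 : ZMod 6) * 2 ∈ (motzkinSet 1 : Set (ZMod 6)) := by
    rw [motzkinSet_one]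
    exact ⟨by decide, by rw [show (2 : ZMod 6) * 2 = 4 by decide]; exact ZMod6.not_isUnit.2.2⟩
  have h4 : motzkinRank ZMod6.forall_exists_not_mem_motzkinSet ((2 : ZMod 6) * 2) = 2 := by
    refine le_antisymm ((motzkinRank_le_iff _).2 ?_) ?_
    · rw [ZMod6.motzkinSet_two_eq_empty]; exact fun h ↦ h
    · by_contra hlt
      exact (motzkinRank_le_iff _).1 (Nat.lt_succ_iff.1 (lt_of_not_ge hlt)) h41
  unfold motzkinNorm
  rw [h4]

/-- **The printed Proposition 12 fails (`θ`-form)**: in `ℤ/6ℤ`, `a = b = 2`, `ab = 4 ≠ 0`, and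
`θ(ab) = 1 < 2 = θ(a) + θ(b)`. [cite: Samuel1971, Prop. 12 (p. 291) — counterexample to the statement as printed] -/
theorem ZMod6.motzkinNorm_two_mul_two_lt :
    (2 : ZMod 6) * 2 ≠ 0 ∧
      motzkinNorm ZMod6.forall_exists_not_mem_motzkinSet ((2 : ZMod 6) * 2) <
        motzkinNorm ZMod6.forall_exists_not_mem_motzkinSet 2 +
          motzkinNorm ZMod6.forall_exists_not_mem_motzkinSet 2 := by
  refine ⟨by decide, ?_⟩
  rw [ZMod6.motzkinNorm_two_mul_two, ZMod6.motzkinNorm_two]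
  decide

/-- So «`θ(ab) ≥ θ(a) + θ(b)` for all non-zero `a, b` with `ab ≠ 0`» is false in `ℤ/6ℤ`: the non-zero-divisor
hypothesis of `motzkinNorm_add_le_motzkinNorm_mul_of_mem_nonZeroDivisors` is needed.
[cite: Samuel1971, Prop. 12 (p. 291) — counterexample to the statement as printed] -/
theorem ZMod6.not_superadditive :
    ¬ ∀ x y : ZMod 6, x * y ≠ 0 →
      motzkinNorm ZMod6.forall_exists_not_mem_motzkinSet x +
          motzkinNorm ZMod6.forall_exists_not_mem_motzkinSet y ≤
        motzkinNorm ZMod6.forall_exists_not_mem_motzkinSet (x * y) := by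
  intro H
  obtain ⟨h0, hlt⟩ := ZMod6.motzkinNorm_two_mul_two_lt
  exact absurd (H 2 2 h0) (not_le.2 hlt)

end Literature.Algebra.EuclideanDomain
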